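import Summits.KontsevichZagierPeriods.KontsevichZagierPeriods.Theorems.UnfoldedStokesStokesGenerationFibrewiseRungPullback
import Literature.NumberTheory.Transcendental.SemialgebraicMapsProofs
import Mathlib.Analysis.SpecialFunctions.Sqrt
import Mathlib.Analysis.Calculus.Deriv.Inv
import Mathlib.Analysis.Calculus.Deriv.Pow
import Mathlib.Analysis.Calculus.Deriv.Mul
import Mathlib.Analysis.Calculus.Deriv.Add

/-!
# `StokesGeneration` (stmt-KontsevichZagierPeriods-3586) — line `fibrewise_stokes`, stub `stub_anchorPieceTwo`

Registered stub A2b (RUNG A — the anchor `π²`, wave 8, lead c6) of the line `fibrewise_stokes` of the crux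
`StokesGeneration` (route UnfoldedStokes). RUNG A puts the first transcendental constant `π²` into the economy of
the residual S2 (`FibStokesDecomposable`, `Theorems/UnfoldedStokesDefs.lean`): the bounded integrand
`k₁(w,y) = 4/((1+yw)(1+y−y(1−y)w))` of the (cut and squared) corner blow-up of Calabi's `4/(1−X²Y²)` is congruent
to twice the apex chart `h₂(s,u) = 4s/((1+s²)(1+s²u²))` of Kontsevich–Zagier's triangle. This stub is the transport
of "piece 2": with `v = z 0`, `y = z 1`, `S = √(2−y²)`, `φ = (1+y)/(S(1+S))`, `X = 1 − (1−y)φv²`,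
`Q = φ(2−(1−y)φv²)/(1+y)`, the face-preserving real-analytic self-map `Ψ₂(v,y) = (v√Q/X, yX)` of the closed square
pulls `h₂ ds du` back to `2vφ·k₁(φv², y) dv dy`, so that rung 15 (`fibStokesDecomposable_sub_pullback`,
Kontsevich–Zagier's rule (2) for face-preserving `C²` self-maps of the cube) gives
`h₂ − 2vφ k₁(φv²,y) ∈ Dec`.

Proof. (1) `anchorTwo_engine` runs rung 15 for an ABSTRACT coefficient `φ(y)`: `C²`, `ℚ`-semialgebraic, positive,
`(1−y)φ ≤ ½` near `[0,1]`, and satisfying on `[0,1]` the quadratic relation `(1+y)(1−(1−y)φ)² = φ(2−(1−y)φ)`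
(which is `Q(1,y) = X(1,y)²`, i.e. the face condition `s(1,y) = 1`, and also yields `s ≤ 1` on the square through
`(1+y)X² − v²(1+y)Q = (2−y²)·φ(1−v²)·(2−(1−y)φ(1+v²)) ≥ 0`). (2) THE JACOBIAN IDENTITY
`h₂(Ψ₂ z)·det DΨ₂(z) = 2vφ k₁(φv²,y)` (`anchorTwo_core`) never differentiates a square root nor `φ`: the entries
`∂ᵥu, ∂_y u` of `u = yX` are polynomial in `(v, y, φ, φ′)` with `φ′` an opaque real, and `s = v√Q/X` enters
`h₂(s,u)·det = 4(s∂ᵥs·∂_yu − s∂_ys·∂ᵥu)/((1+s²)(1+s²u²))` only through `2s∂s = ∂(s²)` and `s²`, where `s² = v²Q/X²`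
is radical-free; the fibre derivatives of `Ψ₂` are identified with one-variable derivatives along coordinate lines
(`hasDerivAt_apply_update_of_hasFDerivAt`, uniqueness of derivatives), and what is left is a rational identity in
`(v, y, φ, φ′)` (`field_simp; ring`; `φ′` cancels, as it must: `Ψ₂ = M ∘ (v,y) ↦ (φv², y)` with `M` free of `φ`).
(3) The explicit `φ` has these properties (`anchorTwo_phi`: `(1−y)φ = 1 − 1/S`).

References: M. Kontsevich, D. Zagier, *Periods* (2001), §1.1 (the example `ζ(2)`), §1.2 rule (2); S. Basu,
R. Pollack, M.-F. Roy, *Algorithms in Real Algebraic Geometry* (2006), Prop. 3.22; J. Bochnak, M. Coste, M.-F. Roy,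
*Real Algebraic Geometry* (1998), Prop. 2.2.6.
-/

noncomputable section

-- `Summit.KontsevichZagierPeriods.KontsevichZagierPeriods.…` is the tree's mandated layout (single-conjunct summit).
set_option linter.dupNamespace false

namespace Summit.KontsevichZagierPeriods.KontsevichZagierPeriods.Cruxes.StokesGeneration.FibrewiseStokes

open MeasureTheory Set Real
open Literature.NumberTheory.Transcendental
open Literature.NumberTheory.Transcendental.KZ
open Literature.ModelTheory.ExponentialFields (IsSemialgebraic)

/-- The open box `(−1/8, 9/8)²` around the closed square is `ℚ`-semialgebraic. [cite: BochnakCosteRoy1998, §2.1] -/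
private theorem anchorTwo_isSemialgebraic_box :
    IsSemialgebraic ℚ {z : Fin 2 → ℝ | (-1 < 8 * z 0 ∧ 8 * z 0 < 9) ∧ (-1 < 8 * z 1 ∧ 8 * z 1 < 9)} := by
  have h : ∀ i : Fin 2, IsSemialgebraic ℚ {z : Fin 2 → ℝ | -1 < 8 * z i ∧ 8 * z i < 9} := fun i => by
    have h1 := Literature.ModelTheory.ExponentialFields.isSemialgebraic_setOf_eval_lt (k := ℚ) (R := ℝ)
      (-1 : MvPolynomial (Fin 2) ℚ) (8 * MvPolynomial.X i)
    have h2 := Literature.ModelTheory.ExponentialFields.isSemialgebraic_setOf_eval_lt (k := ℚ) (R := ℝ)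
      (8 * MvPolynomial.X i : MvPolynomial (Fin 2) ℚ) 9
    simp only [map_neg, map_one, map_mul, MvPolynomial.aeval_X, map_ofNat] at h1 h2
    simpa only [Set.setOf_and] using h1.inter h2
  simpa only [Set.setOf_and] using (h 0).inter (h 1)

/-- **The Jacobian identity, algebraic core.** With `p = φ(y)`, `X = 1 − (1−y)pv²`, `Q = p(2−(1−y)pv²)/(1+y)`,
`s = v√Q/X`, `u = yX`: if `J₀₀, J₀₁` are derivatives of `s` along `v` and `y` (only used through the derivatives
`2sJ = ∂(s²)` of the radical-free `s² = v²Q/X²`) and `J₁₀, J₁₁` those of `u`, then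
`h₂(s,u)·(J₀₀J₁₁ − J₀₁J₁₀) = 2vp·k₁(pv², y)`; `φ′` is arbitrary. [cite: KontsevichZagier2001, §1.2 rule (2)] -/
private theorem anchorTwo_core (φ : ℝ → ℝ) (v y d J00 J01 J10 J11 : ℝ) (hy : 0 < 1 + y)
    (hX : 0 < 1 - (1 - y) * φ y * v ^ 2) (hq : 0 < φ y * (2 - (1 - y) * φ y * v ^ 2) / (1 + y))
    (hk1 : 0 < 1 + y * (φ y * v ^ 2)) (hk2 : 0 < 1 + y - y * (1 - y) * (φ y * v ^ 2)) (hφ' : HasDerivAt φ d y)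
    (H0 : ∀ A : ℝ, HasDerivAt (fun t : ℝ => t ^ 2 * (φ y * (2 - (1 - y) * φ y * t ^ 2) / (1 + y)) /
        (1 - (1 - y) * φ y * t ^ 2) ^ 2) A v →
        J00 * (v * √(φ y * (2 - (1 - y) * φ y * v ^ 2) / (1 + y)) / (1 - (1 - y) * φ y * v ^ 2)) +
          (v * √(φ y * (2 - (1 - y) * φ y * v ^ 2) / (1 + y)) / (1 - (1 - y) * φ y * v ^ 2)) * J00 = A)
    (H1 : ∀ B : ℝ, HasDerivAt (fun t : ℝ => v ^ 2 * (φ t * (2 - (1 - t) * φ t * v ^ 2) / (1 + t)) /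
        (1 - (1 - t) * φ t * v ^ 2) ^ 2) B y →
        J01 * (v * √(φ y * (2 - (1 - y) * φ y * v ^ 2) / (1 + y)) / (1 - (1 - y) * φ y * v ^ 2)) +
          (v * √(φ y * (2 - (1 - y) * φ y * v ^ 2) / (1 + y)) / (1 - (1 - y) * φ y * v ^ 2)) * J01 = B)
    (H10 : ∀ D : ℝ, HasDerivAt (fun t : ℝ => y * (1 - (1 - y) * φ y * t ^ 2)) D v → J10 = D)
    (H11 : ∀ D : ℝ, HasDerivAt (fun t : ℝ => t * (1 - (1 - t) * φ t * v ^ 2)) D y → J11 = D) :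
    4 * (v * √(φ y * (2 - (1 - y) * φ y * v ^ 2) / (1 + y)) / (1 - (1 - y) * φ y * v ^ 2)) /
        ((1 + (v * √(φ y * (2 - (1 - y) * φ y * v ^ 2) / (1 + y)) / (1 - (1 - y) * φ y * v ^ 2)) ^ 2) *
          (1 + (v * √(φ y * (2 - (1 - y) * φ y * v ^ 2) / (1 + y)) / (1 - (1 - y) * φ y * v ^ 2)) ^ 2 *
            (y * (1 - (1 - y) * φ y * v ^ 2)) ^ 2)) *
      (J00 * J11 - J01 * J10) =
    2 * v * (φ y * (4 / ((1 + y * (φ y * v ^ 2)) * (1 + y - y * (1 - y) * (φ y * v ^ 2))))) := by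
  -- the radical-free derivatives, computed by Mathlib and fed to the four uniqueness oracles
  have hXv : HasDerivAt (fun t : ℝ => 1 - (1 - y) * φ y * t ^ 2) _ v :=
    ((hasDerivAt_pow 2 v).const_mul ((1 - y) * φ y)).const_sub 1
  have hQv : HasDerivAt (fun t : ℝ => φ y * (2 - (1 - y) * φ y * t ^ 2) / (1 + y)) _ v :=
    (((hasDerivAt_pow 2 v).const_mul ((1 - y) * φ y)).const_sub 2).const_mul (φ y) |>.div_const (1 + y)
  have hA := H0 _ (((hasDerivAt_pow 2 v).fun_mul hQv).fun_div (hXv.fun_pow 2) (pow_ne_zero 2 hX.ne'))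
  have hm : HasDerivAt (fun t : ℝ => (1 - t) * φ t * v ^ 2) _ y :=
    (((hasDerivAt_id' y).const_sub 1).fun_mul hφ').fun_mul (hasDerivAt_const y (v ^ 2))
  have hQy : HasDerivAt (fun t : ℝ => φ t * (2 - (1 - t) * φ t * v ^ 2) / (1 + t)) _ y :=
    (hφ'.fun_mul (hm.const_sub 2)).fun_div ((hasDerivAt_id' y).const_add 1) hy.ne'
  have hB := H1 _ ((hQy.const_mul (v ^ 2)).fun_div ((hm.const_sub 1).fun_pow 2) (pow_ne_zero 2 hX.ne'))
  have hJ10 := H10 _ ((((hasDerivAt_pow 2 v).const_mul ((1 - y) * φ y)).const_sub 1).const_mul y)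
  have hJ11 := H11 _ ((hasDerivAt_id' y).fun_mul (hm.const_sub 1))
  -- algebra: `s` enters through `2 s J = ∂(s²)` and `s² = v² Q / X²` only
  have hr2 : √(φ y * (2 - (1 - y) * φ y * v ^ 2) / (1 + y)) ^ 2 = φ y * (2 - (1 - y) * φ y * v ^ 2) / (1 + y) :=
    Real.sq_sqrt hq.le
  have key : ∀ s : ℝ, 4 * s * (J00 * J11 - J01 * J10) =
      2 * (J00 * s + s * J00) * J11 - 2 * (J01 * s + s * J01) * J10 := fun s => by ring
  rw [div_mul_eq_mul_div, key, hA, hB, hJ10, hJ11, div_pow, mul_pow, hr2]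
  have hq' : 0 < φ y * (2 - (1 - y) * φ y * v ^ 2) := by
    have h := mul_pos hq hy
    rwa [div_mul_cancel₀ _ hy.ne'] at h
  have hN : (1 + y) + y ^ 2 * v ^ 2 * (φ y * (2 - (1 - y) * φ y * v ^ 2)) ≠ 0 := by positivity
  have hXne := hX.ne'
  have hyne := hy.ne'
  have hk1ne := hk1.ne'
  have hk2ne := hk2.ne'
  set X := 1 - (1 - y) * φ y * v ^ 2 with hXdef
  set K1 := 1 + y * (φ y * v ^ 2) with hK1
  set K2 := 1 + y - y * (1 - y) * (φ y * v ^ 2) with hK2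
  set N := (1 + y) + y ^ 2 * v ^ 2 * (φ y * (2 - (1 - y) * φ y * v ^ 2)) with hNdef
  set Y := 1 + y with hY
  have hD1 : 1 + v ^ 2 * (φ y * (2 - (1 - y) * φ y * v ^ 2) / Y) / X ^ 2 = K1 * K2 / (Y * X ^ 2) := by
    field_simp
    rw [hXdef, hK1, hK2, hY]
    ring
  have hD2 : 1 + v ^ 2 * (φ y * (2 - (1 - y) * φ y * v ^ 2) / Y) / X ^ 2 * (y * X) ^ 2 = N / Y := by
    field_simp
    rw [hNdef, hY]
    ring
  rw [hD1, hD2]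
  field_simp
  simp only [hXdef, hY, hNdef]
  ring

/-- **The engine: rung 15 for the anchor map with an abstract coefficient.** For `φ` of class `C²`, `ℚ`-semialgebraic,
positive with `(1−y)φ(y) ≤ ½` near `[0,1]`, and with `(1+y)(1−(1−y)φ)² = φ(2−(1−y)φ)` on `[0,1]`, the self-map
`Ψ(v,y) = (v√Q/X, yX)` of the closed square is face-preserving and `C²` near it, and rung 15 plus the Jacobian identity
give `h₂ − 2vφ(y)k₁(φ(y)v², y) ∈ Dec`. [cite: KontsevichZagier2001, §1.2 rule (2)] -/
private theorem anchorTwo_engine (φ : ℝ → ℝ) (hφd : ∀ t ∈ Set.Ioo (-1/8 : ℝ) (9/8), ContDiffAt ℝ 2 φ t)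
    (hφsa : IsSemialgebraicFunOn ℚ {z : Fin 2 → ℝ | (-1 < 8 * z 0 ∧ 8 * z 0 < 9) ∧ (-1 < 8 * z 1 ∧ 8 * z 1 < 9)}
      (fun z => φ (z 1)))
    (hφpos : ∀ t ∈ Set.Ioo (-1/8 : ℝ) (9/8), 0 < φ t) (hφle : ∀ t ∈ Set.Ioo (-1/8 : ℝ) (9/8), (1 - t) * φ t ≤ 1 / 2)
    (hφroot : ∀ t ∈ Set.Icc (0:ℝ) 1, (1 + t) * (1 - (1 - t) * φ t) ^ 2 = φ t * (2 - (1 - t) * φ t)) :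
    FibStokesDecomposable 2 (fun z => 4 * z 0 / ((1 + z 0 ^ 2) * (1 + z 0 ^ 2 * z 1 ^ 2)) -
      2 * z 0 * (φ (z 1) * (4 / ((1 + z 1 * (φ (z 1) * z 0 ^ 2)) *
        (1 + z 1 - z 1 * (1 - z 1) * (φ (z 1) * z 0 ^ 2)))))) := by
  set U : Set (Fin 2 → ℝ) := {z | (-1 < 8 * z 0 ∧ 8 * z 0 < 9) ∧ (-1 < 8 * z 1 ∧ 8 * z 1 < 9)} with hU
  have hUsa : IsSemialgebraic ℚ U := hφsa.isSemialgebraic_holds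
  have hUo : IsOpen U := by
    rw [hU]
    simp only [Set.setOf_and]
    exact ((isOpen_lt continuous_const (continuous_const.mul (continuous_apply 0))).inter
      (isOpen_lt (continuous_const.mul (continuous_apply 0)) continuous_const)).inter
      ((isOpen_lt continuous_const (continuous_const.mul (continuous_apply 1))).inter
      (isOpen_lt (continuous_const.mul (continuous_apply 1)) continuous_const))
  have hyU : ∀ z ∈ U, z 1 ∈ Set.Ioo (-1/8 : ℝ) (9/8) := fun z hz => ⟨by linarith [hz.2.1], by linarith [hz.2.2]⟩
  have hvU : ∀ z ∈ U, z 0 ∈ Set.Ioo (-1/8 : ℝ) (9/8) := fun z hz => ⟨by linarith [hz.1.1], by linarith [hz.1.2]⟩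
  have hCU : Set.pi Set.univ (fun _ : Fin 2 => Set.Icc (0:ℝ) 1) ⊆ U := fun z hz => by
    have h0 := hz 0 (Set.mem_univ _)
    have h1 := hz 1 (Set.mem_univ _)
    exact ⟨⟨by linarith [h0.1], by linarith [h0.2]⟩, ⟨by linarith [h1.1], by linarith [h1.2]⟩⟩
  -- positivity of the radicand `Q(v,t)` and of `X(v,t)` for `v, t ∈ (−1/8, 9/8)`
  have hQX : ∀ v ∈ Set.Ioo (-1/8 : ℝ) (9/8), ∀ t ∈ Set.Ioo (-1/8 : ℝ) (9/8),
      0 < φ t * (2 - (1 - t) * φ t * v ^ 2) / (1 + t) ∧ 0 < 1 - (1 - t) * φ t * v ^ 2 := by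
    intro v hv t ht
    have hle := hφle t ht
    have hp := hφpos t ht
    have hv2 : v ^ 2 < 2 := by nlinarith [hv.1, hv.2]
    have h1 : (1 - t) * φ t * v ^ 2 < 1 := by nlinarith [mul_nonneg (sub_nonneg.2 hle) (sq_nonneg v)]
    have h2 : 0 < 1 + t := by linarith [ht.1]
    exact ⟨div_pos (mul_pos hp (by linarith)) h2, by linarith⟩
  -- the map `Ψ` and the integrand `h`
  obtain ⟨Ψ, hΨ⟩ : ∃ Ψ : (Fin 2 → ℝ) → (Fin 2 → ℝ), Ψ = fun z =>
      ![z 0 * √(φ (z 1) * (2 - (1 - z 1) * φ (z 1) * z 0 ^ 2) / (1 + z 1)) / (1 - (1 - z 1) * φ (z 1) * z 0 ^ 2),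
        z 1 * (1 - (1 - z 1) * φ (z 1) * z 0 ^ 2)] := ⟨_, rfl⟩
  have hΨ0 : ∀ z, Ψ z 0 = z 0 * √(φ (z 1) * (2 - (1 - z 1) * φ (z 1) * z 0 ^ 2) / (1 + z 1)) /
      (1 - (1 - z 1) * φ (z 1) * z 0 ^ 2) := fun z => by simp [hΨ]
  have hΨ1 : ∀ z, Ψ z 1 = z 1 * (1 - (1 - z 1) * φ (z 1) * z 0 ^ 2) := fun z => by simp [hΨ]
  obtain ⟨h, hh⟩ : ∃ h : (Fin 2 → ℝ) → ℝ, h = fun z => 4 * z 0 / ((1 + z 0 ^ 2) * (1 + z 0 ^ 2 * z 1 ^ 2)) :=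
    ⟨_, rfl⟩
  -- semialgebraicity
  have hz0 : IsSemialgebraicFunOn ℚ U (fun z => z 0) := isSemialgebraicFunOn_apply hUsa 0
  have hz1 : IsSemialgebraicFunOn ℚ U (fun z => z 1) := isSemialgebraicFunOn_apply hUsa 1
  have h1 : IsSemialgebraicFunOn ℚ U (fun _ => (1:ℝ)) := by simpa using isSemialgebraicFunOn_const_natCast hUsa 1
  have hm : IsSemialgebraicFunOn ℚ U (fun z => (1 - z 1) * φ (z 1) * z 0 ^ 2) :=
    ((h1.fun_sub hz1).fun_mul hφsa).fun_mul (hz0.fun_pow 2)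
  have hQsa : IsSemialgebraicFunOn ℚ U (fun z => φ (z 1) * (2 - (1 - z 1) * φ (z 1) * z 0 ^ 2) / (1 + z 1)) :=
    (hφsa.fun_mul ((isSemialgebraicFunOn_const_ofNat hUsa 2).fun_sub hm)).div (h1.fun_add hz1)
      fun z hz => (by linarith [(hyU z hz).1] : (0:ℝ) < 1 + z 1).ne'
  have hΨsa : IsSemialgebraicMapOn ℚ U Ψ :=
    IsSemialgebraicMapOn.of_forall hUsa (Fin.forall_fin_two.2
      ⟨((hz0.fun_mul hQsa.fun_sqrt).div (h1.fun_sub hm) fun z hz => ((hQX _ (hvU z hz) _ (hyU z hz)).2).ne').congr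
        fun z _ => (hΨ0 z).symm, (hz1.fun_mul (h1.fun_sub hm)).congr fun z _ => (hΨ1 z).symm⟩)
  have hhsa : IsSemialgebraicFunOn ℚ U h := by
    rw [hh]
    exact ((isSemialgebraicFunOn_const_ofNat hUsa 4).fun_mul hz0).div ((h1.fun_add (hz0.fun_pow 2)).fun_mul
      (h1.fun_add ((hz0.fun_pow 2).fun_mul (hz1.fun_pow 2)))) fun z _ => by positivity
  -- regularity
  have hc0 := contDiffOn_apply (n := 2) ℝ ℝ (0 : Fin 2) U
  have hc1 := contDiffOn_apply (n := 2) ℝ ℝ (1 : Fin 2) U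
  have hφc : ContDiffOn ℝ 2 (fun z : Fin 2 → ℝ => φ (z 1)) U := fun z hz =>
    ((hφd _ (hyU z hz)).comp z (contDiffAt_apply ℝ ℝ 1 z)).contDiffWithinAt
  have hmc : ContDiffOn ℝ 2 (fun z : Fin 2 → ℝ => (1 - z 1) * φ (z 1) * z 0 ^ 2) U :=
    ((contDiffOn_const.sub hc1).mul hφc).mul (hc0.pow 2)
  have hQc : ContDiffOn ℝ 2 (fun z : Fin 2 → ℝ => φ (z 1) * (2 - (1 - z 1) * φ (z 1) * z 0 ^ 2) / (1 + z 1)) U :=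
    (hφc.mul (contDiffOn_const.sub hmc)).fun_div (contDiffOn_const.add hc1)
      fun z hz => (by linarith [(hyU z hz).1] : (0:ℝ) < 1 + z 1).ne'
  have hΨc : ContDiffOn ℝ 2 Ψ U :=
    contDiffOn_pi' (Fin.forall_fin_two.2
      ⟨((hc0.mul (hQc.sqrt fun z hz => ((hQX _ (hvU z hz) _ (hyU z hz)).1).ne')).fun_div
        (contDiffOn_const.sub hmc) fun z hz => ((hQX _ (hvU z hz) _ (hyU z hz)).2).ne').congr fun z _ => hΨ0 z,
        (hc1.mul (contDiffOn_const.sub hmc)).congr fun z _ => hΨ1 z⟩)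
  have hhc : ContDiffOn ℝ 1 h U := by
    rw [hh]
    have hc0' := contDiffOn_apply (n := 1) ℝ ℝ (0 : Fin 2) U
    have hc1' := contDiffOn_apply (n := 1) ℝ ℝ (1 : Fin 2) U
    exact (contDiffOn_const.mul hc0').fun_div ((contDiffOn_const.add (hc0'.pow 2)).mul
      (contDiffOn_const.add ((hc0'.pow 2).mul (hc1'.pow 2)))) fun z _ => by positivity
  -- the closed square is mapped into itself, faces into faces
  have hsq : ∀ z ∈ Set.pi Set.univ (fun _ : Fin 2 => Set.Icc (0:ℝ) 1),
      (0 ≤ Ψ z 0 ∧ Ψ z 0 ≤ 1) ∧ (0 ≤ Ψ z 1 ∧ Ψ z 1 ≤ 1) := by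
    intro z hz
    obtain ⟨hv0, hv1⟩ := hz 0 (Set.mem_univ _)
    obtain ⟨hy0, hy1⟩ := hz 1 (Set.mem_univ _)
    obtain ⟨hq, hX⟩ := hQX _ (hvU z (hCU hz)) _ (hyU z (hCU hz))
    have hp := hφpos _ (hyU z (hCU hz))
    have hle := hφle _ (hyU z (hCU hz))
    have hy : 0 < 1 + z 1 := by linarith
    have hX1 : 1 - (1 - z 1) * φ (z 1) * z 0 ^ 2 ≤ 1 := by
      nlinarith [mul_nonneg (mul_nonneg (sub_nonneg.2 hy1) hp.le) (sq_nonneg (z 0))]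
    -- `s² ≤ 1`: `(1+y)X² − (1+y)v²Q = (2−y²)·φ(1−v²)·(2−(1−y)φ(1+v²)) ≥ 0` by the quadratic relation of `φ`
    have hR : z 0 ^ 2 * (φ (z 1) * (2 - (1 - z 1) * φ (z 1) * z 0 ^ 2) / (1 + z 1)) ≤
        (1 - (1 - z 1) * φ (z 1) * z 0 ^ 2) ^ 2 := by
      rw [← mul_div_assoc, div_le_iff₀ hy]
      have key : (1 - (1 - z 1) * φ (z 1) * z 0 ^ 2) ^ 2 * (1 + z 1) -
          z 0 ^ 2 * (φ (z 1) * (2 - (1 - z 1) * φ (z 1) * z 0 ^ 2)) =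
          (2 - z 1 ^ 2) * (φ (z 1) * (1 - z 0 ^ 2)) * (2 - (1 - z 1) * φ (z 1) * (1 + z 0 ^ 2)) := by
        linear_combination hφroot (z 1) ⟨hy0, hy1⟩
      have h3 : 0 ≤ (2 - z 1 ^ 2) * (φ (z 1) * (1 - z 0 ^ 2)) * (2 - (1 - z 1) * φ (z 1) * (1 + z 0 ^ 2)) :=
        mul_nonneg (mul_nonneg (by nlinarith) (mul_nonneg hp.le (by nlinarith)))
          (by nlinarith [mul_nonneg (sub_nonneg.2 hle) (sq_nonneg (z 0)), mul_nonneg (sub_nonneg.2 hy1) hp.le])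
      nlinarith [key, h3]
    have hs1 : z 0 * √(φ (z 1) * (2 - (1 - z 1) * φ (z 1) * z 0 ^ 2) / (1 + z 1)) ≤
        1 - (1 - z 1) * φ (z 1) * z 0 ^ 2 := by
      have h := Real.sqrt_le_sqrt hR
      rwa [Real.sqrt_mul (sq_nonneg _), Real.sqrt_sq hv0, Real.sqrt_sq hX.le] at h
    rw [hΨ0, hΨ1]
    exact ⟨⟨div_nonneg (mul_nonneg hv0 (Real.sqrt_nonneg _)) hX.le, (div_le_one hX).2 hs1⟩,
      mul_nonneg hy0 hX.le, mul_le_one₀ hy1 hX.le hX1⟩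
  have hmaps : Set.MapsTo Ψ (Set.pi Set.univ (fun _ : Fin 2 => Set.Icc (0:ℝ) 1))
      (Set.pi Set.univ (fun _ : Fin 2 => Set.Icc (0:ℝ) 1)) := fun z hz =>
    Set.mem_univ_pi.2 (Fin.forall_fin_two.2 ⟨⟨(hsq z hz).1.1, (hsq z hz).1.2⟩, ⟨(hsq z hz).2.1, (hsq z hz).2.2⟩⟩)
  have hface : ∀ z ∈ Set.pi Set.univ (fun _ : Fin 2 => Set.Icc (0:ℝ) 1), ∀ j : Fin 2,
      (z j = 0 → Ψ z j = 0) ∧ (z j = 1 → Ψ z j = 1) := by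
    intro z hz
    obtain ⟨hy0, hy1⟩ := hz 1 (Set.mem_univ _)
    have hy : (1 + z 1) ≠ 0 := by linarith
    refine Fin.forall_fin_two.2 ⟨⟨fun h0 => by rw [hΨ0, h0]; simp, fun h1 => ?_⟩,
      ⟨fun h0 => by rw [hΨ1, h0, zero_mul], fun h1 => by rw [hΨ1, h1]; ring⟩⟩
    have hX : 0 < 1 - (1 - z 1) * φ (z 1) * 1 ^ 2 := by
      have := (hQX 1 (by norm_num) _ (hyU z (hCU hz))).2
      simpa using this
    have hQ1 : φ (z 1) * (2 - (1 - z 1) * φ (z 1) * 1 ^ 2) / (1 + z 1) = (1 - (1 - z 1) * φ (z 1) * 1 ^ 2) ^ 2 := by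
      rw [div_eq_iff hy]
      linear_combination -hφroot (z 1) ⟨hy0, hy1⟩
    rw [hΨ0, h1, hQ1, Real.sqrt_sq hX.le, one_mul, div_self hX.ne']
  -- rung 15, and the Jacobian identity at every point of the closed square
  refine fibStokesDecomposable_congr_off_null 2 _ _ ∅ Literature.ModelTheory.ExponentialFields.isSemialgebraic_empty
    measure_empty (fun z hz _ => ?_) (fibStokesDecomposable_sub_pullback U hUo hCU Ψ h hΨsa hhsa hΨc hhc hmaps hface)
  have hzU := hCU hz
  obtain ⟨hv0, hv1⟩ := hz 0 (Set.mem_univ _)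
  obtain ⟨hy0, hy1⟩ := hz 1 (Set.mem_univ _)
  obtain ⟨hq, hX⟩ := hQX _ (hvU z hzU) _ (hyU z hzU)
  have hp := hφpos _ (hyU z hzU)
  have hle := hφle _ (hyU z hzU)
  have hy : 0 < 1 + z 1 := by linarith
  have hk1 : 0 < 1 + z 1 * (φ (z 1) * z 0 ^ 2) :=
    add_pos_of_pos_of_nonneg one_pos (mul_nonneg hy0 (mul_nonneg hp.le (sq_nonneg _)))
  have hk2 : 0 < 1 + z 1 - z 1 * (1 - z 1) * (φ (z 1) * z 0 ^ 2) := by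
    have h1 : (1 - z 1) * φ (z 1) * z 0 ^ 2 ≤ 1 / 2 := by
      nlinarith [mul_nonneg (mul_nonneg (sub_nonneg.2 hy1) hp.le) (sub_nonneg.2 (show z 0 ^ 2 ≤ 1 by nlinarith))]
    nlinarith [mul_nonneg hy0 (sub_nonneg.2 h1)]
  have hL := ((hΨc.differentiableOn (by norm_num)).differentiableAt (hUo.mem_nhds hzU)).hasFDerivAt
  have hline := fun j k => hasDerivAt_apply_update_of_hasFDerivAt hL j k
  have hu1 : ∀ s : ℝ, Function.update z 0 s 1 = z 1 := fun s => Function.update_of_ne (by decide) s z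
  have hu0 : ∀ s : ℝ, Function.update z 1 s 0 = z 0 := fun s => Function.update_of_ne (by decide) s z
  have h00 := hline 0 0
  have h01 := hline 1 0
  have h10 := hline 0 1
  have h11 := hline 1 1
  simp only [hΨ0, hΨ1, Function.update_self, hu1, hu0] at h00 h01 h10 h11
  have hφ' : HasDerivAt φ (deriv φ (z 1)) (z 1) := ((hφd _ (hyU z hzU)).differentiableAt (by norm_num)).hasDerivAt
  rw [hh]
  beta_reduce
  have hdet : (fderiv ℝ Ψ z).det = (Literature.Analysis.Calculus.jacobianMatrix Ψ z).det :=
    (Literature.Analysis.Calculus.det_jacobianMatrix Ψ z).symm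
  rw [hdet, Matrix.det_fin_two]
  simp only [Literature.Analysis.Calculus.jacobianMatrix_apply, hΨ0, hΨ1]
  rw [sub_right_inj]
  refine anchorTwo_core φ (z 0) (z 1) (deriv φ (z 1)) _ _ _ _ hy hX hq hk1 hk2 hφ' (fun A hA => ?_)
    (fun B hB => ?_) (fun D hD => h10.unique hD) (fun D hD => h11.unique hD)
  · refine (h00.fun_mul h00).unique (hA.congr_of_eventuallyEq ?_)
    filter_upwards [Ioo_mem_nhds (hvU z hzU).1 (hvU z hzU).2] with t ht
    rw [div_mul_div_comm, mul_mul_mul_comm, Real.mul_self_sqrt (hQX t ht _ (hyU z hzU)).1.le]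
    ring
  · refine (h01.fun_mul h01).unique (hB.congr_of_eventuallyEq ?_)
    filter_upwards [Ioo_mem_nhds (hyU z hzU).1 (hyU z hzU).2] with t ht
    rw [div_mul_div_comm, mul_mul_mul_comm, Real.mul_self_sqrt (hQX _ (hvU z hzU) t ht).1.le]
    ring

/-- The explicit coefficient `φ(t) = (1+t)/(S(1+S))`, `S = √(2−t²)`, near `[0,1]`: positive, `(1−t)φ = 1 − 1/S ≤ ½`,
the quadratic relation `(1+t)(1−(1−t)φ)² = φ(2−(1−t)φ)` (i.e. `Q(1,t) = X(1,t)² = 1/S²`), and `C²`. [folklore] -/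
private theorem anchorTwo_phi (t : ℝ) (ht : t ∈ Set.Ioo (-1/8 : ℝ) (9/8)) :
    0 < (1 + t) / (√(2 - t ^ 2) * (1 + √(2 - t ^ 2))) ∧
    (1 - t) * ((1 + t) / (√(2 - t ^ 2) * (1 + √(2 - t ^ 2)))) ≤ 1 / 2 ∧
    (1 + t) * (1 - (1 - t) * ((1 + t) / (√(2 - t ^ 2) * (1 + √(2 - t ^ 2))))) ^ 2 =
      (1 + t) / (√(2 - t ^ 2) * (1 + √(2 - t ^ 2))) *
        (2 - (1 - t) * ((1 + t) / (√(2 - t ^ 2) * (1 + √(2 - t ^ 2))))) ∧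
    ContDiffAt ℝ 2 (fun t : ℝ => (1 + t) / (√(2 - t ^ 2) * (1 + √(2 - t ^ 2)))) t := by
  obtain ⟨ht1, ht2⟩ := ht
  have h2 : 0 < 2 - t ^ 2 := by nlinarith
  have hd : ContDiffAt ℝ 2 (fun t : ℝ => (1 + t) / (√(2 - t ^ 2) * (1 + √(2 - t ^ 2)))) t := by
    have h2' : 2 - t ^ 2 ≠ 0 := h2.ne'
    have h3 : √(2 - t ^ 2) * (1 + √(2 - t ^ 2)) ≠ 0 := by positivity
    fun_prop (disch := assumption)
  set S := √(2 - t ^ 2) with hS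
  have hS0 : 0 < S := Real.sqrt_pos.2 h2
  have hS2 : S ^ 2 = 2 - t ^ 2 := Real.sq_sqrt h2.le
  have key : (1 - t) * ((1 + t) / (S * (1 + S))) = 1 - 1 / S := by
    field_simp
    linear_combination -hS2
  refine ⟨div_pos (by linarith) (by positivity), ?_, ?_, hd⟩
  · rw [key, sub_le_comm, le_div_iff₀ hS0]
    nlinarith [sq_nonneg t]
  · rw [key]
    field_simp
    ring

/-- **Registered stub `stub_anchorPieceTwo` (RUNG A, A2b): transport of piece 2 of the anchor `π²` onto the apex
chart of Kontsevich–Zagier's triangle.** With `v = z 0`, `y = z 1`, `φ = (1+y)/(√(2−y²)(1+√(2−y²)))`, the relator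
`h₂(v,y) − 2vφ·k₁(φv², y)`, `h₂(s,u) = 4s/((1+s²)(1+s²u²))`, `k₁(w,y) = 4/((1+yw)(1+y−y(1−y)w))`, is fibrewise-Stokes
decomposable: it is Kontsevich–Zagier's rule (2) (rung 15, `fibStokesDecomposable_sub_pullback`) for the
face-preserving analytic self-map `Ψ₂(v,y) = (v√Q/X, yX)` of the closed square, `X = 1 − (1−y)φv²`,
`Q = φ(2−(1−y)φv²)/(1+y)`, whose pull-back identity is `(h₂∘Ψ₂)·det DΨ₂ = 2vφ k₁(φv²,y)`.
[cite: KontsevichZagier2001, §1.2 rule (2)] -/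
theorem stub_anchorPieceTwo :
    FibStokesDecomposable 2 (fun z => 4 * z 0 / ((1 + z 0 ^ 2) * (1 + z 0 ^ 2 * z 1 ^ 2)) -
      2 * z 0 * ((1 + z 1) / (Real.sqrt (2 - z 1 ^ 2) * (1 + Real.sqrt (2 - z 1 ^ 2))) *
        (4 / ((1 + z 1 * ((1 + z 1) / (Real.sqrt (2 - z 1 ^ 2) * (1 + Real.sqrt (2 - z 1 ^ 2))) * z 0 ^ 2)) *
          (1 + z 1 - z 1 * (1 - z 1) *
            ((1 + z 1) / (Real.sqrt (2 - z 1 ^ 2) * (1 + Real.sqrt (2 - z 1 ^ 2))) * z 0 ^ 2)))))) := by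
  have hI : Set.Icc (0:ℝ) 1 ⊆ Set.Ioo (-1/8 : ℝ) (9/8) := fun t ht => ⟨by linarith [ht.1], by linarith [ht.2]⟩
  refine anchorTwo_engine (fun t => (1 + t) / (√(2 - t ^ 2) * (1 + √(2 - t ^ 2))))
    (fun t ht => (anchorTwo_phi t ht).2.2.2) ?_ (fun t ht => (anchorTwo_phi t ht).1)
    (fun t ht => (anchorTwo_phi t ht).2.1) (fun t ht => (anchorTwo_phi t (hI ht)).2.2.1)
  -- `z ↦ φ (z 1)` is `ℚ`-semialgebraic on the box
  have hU := anchorTwo_isSemialgebraic_box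
  have hz1 := isSemialgebraicFunOn_apply hU 1
  have h1 : IsSemialgebraicFunOn ℚ {z : Fin 2 → ℝ | (-1 < 8 * z 0 ∧ 8 * z 0 < 9) ∧ (-1 < 8 * z 1 ∧ 8 * z 1 < 9)}
      (fun _ => (1:ℝ)) := by simpa using isSemialgebraicFunOn_const_natCast hU 1
  have hS := ((isSemialgebraicFunOn_const_ofNat hU 2).fun_sub (hz1.fun_pow 2)).fun_sqrt
  refine (h1.fun_add hz1).div (hS.fun_mul (h1.fun_add hS)) fun z hz => ?_
  have h2 : 0 < 2 - z 1 ^ 2 := by nlinarith [hz.2.1, hz.2.2]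
  positivity

end Summit.KontsevichZagierPeriods.KontsevichZagierPeriods.Cruxes.StokesGeneration.FibrewiseStokes

end
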